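import Mathlib
import Literature.Geometry.Lorentzian.BackgroundChartCalculus

/-!
# Route StarvedNecks — crux `GapDecaySuffices` (stmt-FinalStateConjecture-18060), line `Sketch`:
# parity-relabel bricks (1/3) for the assembly stub `stub_assembly`: parity data, the affine
# involution `Q̃`, covariance of the boosted Kerr background, `Cᵏ` pullback norms

Step (ii) of the assembly (`CertificateAfterRelabelling`) is the PARITY RELABELLING of the holes of an
honest final-state decomposition: a hole label `(Λ, c)` with chart `Ψ` becomes `(Λ Q, c)` with chart
`Ψ ∘ Q̃`, for a Lorentz involution `Q` fixing `∂₀`, the rest-frame velocity `u = Λ⁻¹ ∂₀` and the axis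
coordinate `x³` (a `ParityDatum Λ`; instances: `Q = 1`, and the orientation-reversing reflection of
file (2/3) `…RelabelReflection`).  Here, for such a `Q`:

* `Q` is a Euclidean isometry preserving `x⁰`, `‖x⃗‖` and every Kerr–Schild radius `Kerr.radius a`;
* the lab-frame conjugate `L = Λ Q Λ⁻¹` fixes `∂₀` and `Λ ∂₀`, is a Euclidean isometry, `L² = 1`; the
  affine involution `Q̃ x = c + L (x − c)` preserves the hole clock, the hole radius, the flat time
  and the boosted Kerr exterior of `(Λ, c)`, which is also the exterior of `(Λ Q, c)` (same clock, same
  radius), and `boostedKerrBilin (Λ Q) c M a` is the pullback of `boostedKerrBilin Λ c M a` along `Q̃`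
  (by DEFINITION of the boosted form — no symmetry of Kerr is involved);
* `Cᵏ` sup norms of fields of bilinear forms are invariant under pullback along affine Euclidean
  isometries (`supCkENorm_bilinPullback_affine`).

Mathlib + `Literature.Geometry.Lorentzian.*`; no named facts, no `sorry`.
References: O'Neill 1983, Ch. 9 (Lorentz group); Kerr–Schild 1965 (Lorentz covariance of the ansatz).
-/

noncomputable section

open scoped Manifold ContDiff Topology ENNReal RealInnerProductSpace
open Filter Set Function Topology Literature.Geometry.Lorentzian

namespace Summit.FinalStateConjecture.FinalStateConjecture.Theorems.GapDecaySuffices.Relabel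

set_option linter.dupNamespace false

/-! ## §0 Two identities on `E4` -/

/-- `‖x⃗‖² = ‖x‖² − (x⁰)²` on `E4`. [folklore] -/
theorem spatialNorm_sq_eq (x : E4) : E4.spatialNorm x ^ 2 = ‖x‖ ^ 2 - x 0 ^ 2 := by
  rw [E4.spatialNorm_sq, EuclideanSpace.real_norm_sq_eq, Fin.sum_univ_four]
  ring

/-- `η(v, w) = ⟪v, w⟫ − 2 v⁰ w⁰` on `E4`. [folklore] -/
theorem minkowski_bilin_eq_inner_sub (v w : E4) : Minkowski.bilin v w = ⟪v, w⟫ - 2 * (v 0 * w 0) := by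
  have h : ⟪v, w⟫ = v 0 * w 0 + v 1 * w 1 + v 2 * w 2 + v 3 * w 3 := by
    simp only [PiLp.inner_apply, RCLike.inner_apply, conj_trivial, Fin.sum_univ_four]; ring
  rw [Minkowski.bilin_apply, h, Fin.sum_univ_three]
  simp only [Fin.succ_zero_eq_one, Fin.succ_one_eq_two]
  rw [show (2 : Fin 3).succ = (3 : Fin 4) by decide]
  ring

/-! ## §1 Parity data of a motion -/

/-- **Parity data for a motion `Λ`**: a Lorentz involution `Q` fixing `∂₀`, the rest-frame velocity
`Λ⁻¹ ∂₀` and the axis coordinate `x³` — so `Q = 1 ⊕ Q̄` with `Q̄ ∈ O(3)`; instances are `Q = 1`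
(`oneDatum`) and the mirror across the plane `⟨ū, ∂₃⟩` (`holeDatum`, `det = −1`, file 2/3). [folklore] -/
structure ParityDatum (Λ : lorentzGroup) where
  /-- The rest-frame involution `Q`. -/
  Q : lorentzGroup
  /-- `Q² = 1`. -/
  apply_apply : ∀ v, (Q : E4 ≃L[ℝ] E4) ((Q : E4 ≃L[ℝ] E4) v) = v
  /-- `Q ∂₀ = ∂₀`. -/
  map_basisVector_zero : (Q : E4 ≃L[ℝ] E4) (E4.basisVector 0) = E4.basisVector 0
  /-- `Q (Λ⁻¹ ∂₀) = Λ⁻¹ ∂₀`. -/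
  map_restVel : (Q : E4 ≃L[ℝ] E4) ((Λ : E4 ≃L[ℝ] E4).symm (E4.basisVector 0)) =
    (Λ : E4 ≃L[ℝ] E4).symm (E4.basisVector 0)
  /-- `(Q v)³ = v³`. -/
  apply_three : ∀ v, (Q : E4 ≃L[ℝ] E4) v 3 = v 3

/-- The trivial parity datum `Q = 1`. [folklore] -/
def oneDatum (Λ : lorentzGroup) : ParityDatum Λ := ⟨1, fun _ ↦ rfl, rfl, rfl, fun _ ↦ rfl⟩

namespace ParityDatum

variable {Λ : lorentzGroup} (P : ParityDatum Λ)

/-- `Q⁻¹ = Q`. [folklore] -/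
theorem symm_apply (v : E4) : (P.Q : E4 ≃L[ℝ] E4).symm v = (P.Q : E4 ≃L[ℝ] E4) v := by
  rw [ContinuousLinearEquiv.symm_apply_eq, P.apply_apply]

/-- `(Q v)⁰ = v⁰` (a Lorentz map fixing `∂₀` preserves `−η(∂₀, ·)`). [folklore] -/
@[simp] theorem apply_zero (v : E4) : (P.Q : E4 ≃L[ℝ] E4) v 0 = v 0 := by
  have h1 := P.Q.2 (E4.basisVector 0) v
  rw [P.map_basisVector_zero, Minkowski.bilin_basisVector_zero_left,
    Minkowski.bilin_basisVector_zero_left] at h1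
  linarith

/-- `‖Q v‖ = ‖v‖` (a Lorentz map fixing `∂₀` is a Euclidean isometry). [folklore] -/
@[simp] theorem norm_map (v : E4) : ‖(P.Q : E4 ≃L[ℝ] E4) v‖ = ‖v‖ := by
  have h1 := P.Q.2 v v
  rw [minkowski_bilin_eq_inner_sub, minkowski_bilin_eq_inner_sub, P.apply_zero, real_inner_self_eq_norm_sq,
    real_inner_self_eq_norm_sq] at h1
  have h2 : ‖(P.Q : E4 ≃L[ℝ] E4) v‖ ^ 2 = ‖v‖ ^ 2 := by linarith
  exact (sq_eq_sq₀ (norm_nonneg _) (norm_nonneg _)).1 h2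

/-- `Q` as a Euclidean linear isometry of `E4`. [folklore] -/
def iso : E4 ≃ₗᵢ[ℝ] E4 := { (P.Q : E4 ≃L[ℝ] E4).toLinearEquiv with norm_map' := P.norm_map }

/-- `P.iso` is `Q`. [folklore] -/
@[simp] theorem iso_apply (v : E4) : P.iso v = (P.Q : E4 ≃L[ℝ] E4) v := rfl

/-- `Q` preserves the spatial radius `‖x⃗‖`. [folklore] -/
@[simp] theorem spatialNorm_map (v : E4) : E4.spatialNorm ((P.Q : E4 ≃L[ℝ] E4) v) = E4.spatialNorm v := by
  have h1 := spatialNorm_sq_eq ((P.Q : E4 ≃L[ℝ] E4) v)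
  rw [P.norm_map, P.apply_zero, ← spatialNorm_sq_eq] at h1
  exact (sq_eq_sq₀ (E4.spatialNorm_nonneg _) (E4.spatialNorm_nonneg _)).1 h1

/-- `Q` preserves the Kerr–Schild radius of EVERY spin `a` (it preserves `‖x⃗‖` and `x³`). [folklore] -/
@[simp] theorem kerr_radius_map (a : ℝ) (v : E4) :
    Kerr.radius a ((P.Q : E4 ≃L[ℝ] E4) v) = Kerr.radius a v := by
  unfold Kerr.radius
  rw [P.spatialNorm_map, P.apply_three]

end ParityDatum

/-! ## §2 The relabelled motion `Λ Q`, the lab-frame conjugate `L = Λ Q Λ⁻¹`, and `Q̃ x = c + L (x − c)` -/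

section Conj

variable {Λ : lorentzGroup} (P : ParityDatum Λ) (c : E4)

/-- The relabelled motion `Λ Q`. [folklore] -/
abbrev relabelMotion : lorentzGroup := Λ * P.Q

/-- The lab-frame conjugate `L := Λ Q Λ⁻¹`. [folklore] -/
def labRefl : lorentzGroup := Λ * P.Q * Λ⁻¹

/-- `(Λ Q) v = Λ (Q v)`. [folklore] -/
theorem relabelMotion_apply (v : E4) :
    ((relabelMotion P : lorentzGroup) : E4 ≃L[ℝ] E4) v = (Λ : E4 ≃L[ℝ] E4) ((P.Q : E4 ≃L[ℝ] E4) v) := rfl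

/-- `(Λ Q)⁻¹ v = Q (Λ⁻¹ v)`. [folklore] -/
theorem relabelMotion_symm_apply (v : E4) :
    ((relabelMotion P : lorentzGroup) : E4 ≃L[ℝ] E4).symm v =
      (P.Q : E4 ≃L[ℝ] E4) ((Λ : E4 ≃L[ℝ] E4).symm v) := by
  show ((P.Q : lorentzGroup) : E4 ≃L[ℝ] E4).symm ((Λ : E4 ≃L[ℝ] E4).symm v) = _
  rw [P.symm_apply]

/-- `L v = Λ Q Λ⁻¹ v`. [folklore] -/
theorem labRefl_apply (v : E4) :
    ((labRefl P : lorentzGroup) : E4 ≃L[ℝ] E4) v =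
      (Λ : E4 ≃L[ℝ] E4) ((P.Q : E4 ≃L[ℝ] E4) ((Λ : E4 ≃L[ℝ] E4).symm v)) := rfl

/-- `(Λ Q) ∂₀ = Λ ∂₀`: relabelling does not change the asymptotic four-velocity. [folklore] -/
theorem relabelMotion_basisVector_zero :
    ((relabelMotion P : lorentzGroup) : E4 ≃L[ℝ] E4) (E4.basisVector 0) =
      (Λ : E4 ≃L[ℝ] E4) (E4.basisVector 0) := by
  rw [relabelMotion_apply, P.map_basisVector_zero]

/-- `‖Λ Q‖ = ‖Λ‖` (operator norms; `Q` is a surjective Euclidean isometry). [folklore] -/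
theorem norm_relabelMotion :
    ‖(((relabelMotion P : lorentzGroup) : E4 ≃L[ℝ] E4) : E4 →L[ℝ] E4)‖ =
      ‖((Λ : E4 ≃L[ℝ] E4) : E4 →L[ℝ] E4)‖ := by
  have h : (((relabelMotion P : lorentzGroup) : E4 ≃L[ℝ] E4) : E4 →L[ℝ] E4) =
      ((Λ : E4 ≃L[ℝ] E4) : E4 →L[ℝ] E4).comp ((P.iso : E4 ≃ₗᵢ[ℝ] E4) : E4 →L[ℝ] E4) := by
    ext v; rfl
  rw [h, ContinuousLinearMap.opNorm_comp_linearIsometryEquiv]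

/-- `L ∂₀ = ∂₀`. [folklore] -/
theorem labRefl_basisVector_zero :
    ((labRefl P : lorentzGroup) : E4 ≃L[ℝ] E4) (E4.basisVector 0) = E4.basisVector 0 := by
  rw [labRefl_apply, P.map_restVel, ContinuousLinearEquiv.apply_symm_apply]

/-- `L` preserves the time coordinate. [folklore] -/
@[simp] theorem labRefl_apply_zero (v : E4) : (((labRefl P : lorentzGroup) : E4 ≃L[ℝ] E4) v) 0 = v 0 := by
  have h1 := (labRefl P).2 (E4.basisVector 0) v
  rw [labRefl_basisVector_zero, Minkowski.bilin_basisVector_zero_left,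
    Minkowski.bilin_basisVector_zero_left] at h1
  linarith

/-- `L` is a Euclidean isometry. [folklore] -/
@[simp] theorem norm_labRefl (v : E4) : ‖((labRefl P : lorentzGroup) : E4 ≃L[ℝ] E4) v‖ = ‖v‖ := by
  have h1 := (labRefl P).2 v v
  rw [minkowski_bilin_eq_inner_sub, minkowski_bilin_eq_inner_sub, labRefl_apply_zero,
    real_inner_self_eq_norm_sq, real_inner_self_eq_norm_sq] at h1
  have h2 : ‖((labRefl P : lorentzGroup) : E4 ≃L[ℝ] E4) v‖ ^ 2 = ‖v‖ ^ 2 := by linarith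
  exact (sq_eq_sq₀ (norm_nonneg _) (norm_nonneg _)).1 h2

/-- `L² = 1`. [folklore] -/
theorem labRefl_labRefl (v : E4) :
    ((labRefl P : lorentzGroup) : E4 ≃L[ℝ] E4) (((labRefl P : lorentzGroup) : E4 ≃L[ℝ] E4) v) = v := by
  rw [labRefl_apply, labRefl_apply, ContinuousLinearEquiv.symm_apply_apply, P.apply_apply,
    ContinuousLinearEquiv.apply_symm_apply]

/-- `L (Λ ∂₀) = Λ ∂₀`. [folklore] -/
theorem labRefl_map_motion_basisVector_zero :
    ((labRefl P : lorentzGroup) : E4 ≃L[ℝ] E4) ((Λ : E4 ≃L[ℝ] E4) (E4.basisVector 0)) =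
      (Λ : E4 ≃L[ℝ] E4) (E4.basisVector 0) := by
  rw [labRefl_apply, ContinuousLinearEquiv.symm_apply_apply, P.map_basisVector_zero]

/-- `L` as a Euclidean linear isometry of `E4`. [folklore] -/
def labReflIso : E4 ≃ₗᵢ[ℝ] E4 :=
  { ((labRefl P : lorentzGroup) : E4 ≃L[ℝ] E4).toLinearEquiv with norm_map' := norm_labRefl P }

/-- `labReflIso` is `L`. [folklore] -/
@[simp] theorem labReflIso_apply (v : E4) : labReflIso P v = ((labRefl P : lorentzGroup) : E4 ≃L[ℝ] E4) v :=
  rfl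

/-- **The affine involution `Q̃ x = c + L (x − c)`** of `E4` (lab frame). [folklore] -/
def reflAffine (x : E4) : E4 := c + ((labRefl P : lorentzGroup) : E4 ≃L[ℝ] E4) (x - c)

/-- `Q̃² = id`. [folklore] -/
theorem reflAffine_reflAffine (x : E4) : reflAffine P c (reflAffine P c x) = x := by
  simp only [reflAffine, add_sub_cancel_left, labRefl_labRefl, add_sub_cancel]

/-- `Q̃` preserves the flat time. [folklore] -/
@[simp] theorem reflAffine_apply_zero (x : E4) : reflAffine P c x 0 = x 0 := by
  simp [reflAffine]

/-- `Q̃ = c + L(· − c)` through the isometry `labReflIso`. [folklore] -/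
theorem reflAffine_eq_labReflIso (x : E4) : reflAffine P c x = c + labReflIso P (x - c) := rfl

/-- Rest-frame coordinates of `Q̃ x` are the reflected rest-frame coordinates of `x`. [folklore] -/
theorem poincareInv_reflAffine (x : E4) :
    poincareInv Λ c (reflAffine P c x) = (P.Q : E4 ≃L[ℝ] E4) (poincareInv Λ c x) := by
  simp only [poincareInv, reflAffine, add_sub_cancel_left, labRefl_apply, ContinuousLinearEquiv.symm_apply_apply]

/-- Rest-frame coordinates for the relabelled motion are the reflected rest-frame coordinates. [folklore] -/
theorem poincareInv_relabelMotion (x : E4) :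
    poincareInv (relabelMotion P) c x = (P.Q : E4 ≃L[ℝ] E4) (poincareInv Λ c x) := by
  simp only [poincareInv, relabelMotion_symm_apply]

/-- `Q̃` is smooth. [folklore] -/
theorem contDiff_reflAffine : ContDiff ℝ ∞ (reflAffine P c) :=
  contDiff_const.add ((((labRefl P : lorentzGroup) : E4 ≃L[ℝ] E4) : E4 →L[ℝ] E4).contDiff.comp
    (contDiff_id.sub contDiff_const))

/-- `DQ̃ = L`. [folklore] -/
theorem hasFDerivAt_reflAffine (x : E4) :
    HasFDerivAt (reflAffine P c) (((labRefl P : lorentzGroup) : E4 ≃L[ℝ] E4) : E4 →L[ℝ] E4) x := by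
  have h := (((((labRefl P : lorentzGroup) : E4 ≃L[ℝ] E4) : E4 →L[ℝ] E4).hasFDerivAt (x := x - c)).comp x
    ((hasFDerivAt_id x).sub_const c)).const_add c
  rw [ContinuousLinearMap.comp_id] at h
  exact h

/-- `fderiv Q̃ = L`. [folklore] -/
theorem fderiv_reflAffine (x : E4) :
    fderiv ℝ (reflAffine P c) x = (((labRefl P : lorentzGroup) : E4 ≃L[ℝ] E4) : E4 →L[ℝ] E4) :=
  (hasFDerivAt_reflAffine P c x).fderiv

/-- `Q̃` is continuous. [folklore] -/
theorem continuous_reflAffine : Continuous (reflAffine P c) := (contDiff_reflAffine P c).continuous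

/-! ### The relabelled boosted Kerr background -/

variable (M a : ℝ)

/-- `Q̃` preserves the boosted Kerr exterior. [folklore] -/
theorem mem_boostedKerrExterior_reflAffine_iff (x : E4) :
    reflAffine P c x ∈ boostedKerrExterior Λ c M a ↔ x ∈ boostedKerrExterior Λ c M a := by
  simp only [mem_boostedKerrExterior, Kerr.mem_exterior, poincareInv_reflAffine, P.kerr_radius_map]

/-- The exterior of the relabelled motion is the old exterior (pointwise). [folklore] -/
theorem mem_boostedKerrExterior_relabelMotion_iff (x : E4) :
    x ∈ boostedKerrExterior (relabelMotion P) c M a ↔ x ∈ boostedKerrExterior Λ c M a := by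
  simp only [mem_boostedKerrExterior, Kerr.mem_exterior, poincareInv_relabelMotion, P.kerr_radius_map]

/-- Relabelling does not change the boosted Kerr exterior. [folklore] -/
theorem boostedKerrExterior_relabelMotion :
    boostedKerrExterior (relabelMotion P) c M a = boostedKerrExterior Λ c M a :=
  TopologicalSpace.Opens.ext (Set.ext fun x ↦ mem_boostedKerrExterior_relabelMotion_iff P c M a x)

/-- Relabelling does not change the background domain. [folklore] -/
theorem boostedKerrBackground_relabelMotion_domain :
    (boostedKerrBackground (relabelMotion P) c M a).domain = (boostedKerrBackground Λ c M a).domain :=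
  boostedKerrExterior_relabelMotion P c M a

/-- Relabelling does not change the hole clock. [folklore] -/
theorem boostedKerrBackground_relabelMotion_time :
    (boostedKerrBackground (relabelMotion P) c M a).time = (boostedKerrBackground Λ c M a).time := by
  funext x
  show poincareInv (relabelMotion P) c x 0 = poincareInv Λ c x 0
  rw [poincareInv_relabelMotion, P.apply_zero]

/-- Relabelling does not change the hole radius. [folklore] -/
theorem boostedKerrBackground_relabelMotion_radius :
    (boostedKerrBackground (relabelMotion P) c M a).radius = (boostedKerrBackground Λ c M a).radius := by
  funext x
  show Kerr.radius a (poincareInv (relabelMotion P) c x) = Kerr.radius a (poincareInv Λ c x)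
  rw [poincareInv_relabelMotion, P.kerr_radius_map]

/-- `Q̃` preserves the hole clock. [folklore] -/
@[simp] theorem time_reflAffine (x : E4) :
    (boostedKerrBackground Λ c M a).time (reflAffine P c x) = (boostedKerrBackground Λ c M a).time x := by
  show poincareInv Λ c (reflAffine P c x) 0 = poincareInv Λ c x 0
  rw [poincareInv_reflAffine, P.apply_zero]

/-- `Q̃` preserves the hole radius. [folklore] -/
@[simp] theorem radius_reflAffine (x : E4) :
    (boostedKerrBackground Λ c M a).radius (reflAffine P c x) = (boostedKerrBackground Λ c M a).radius x := by
  show Kerr.radius a (poincareInv Λ c (reflAffine P c x)) = Kerr.radius a (poincareInv Λ c x)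
  rw [poincareInv_reflAffine, P.kerr_radius_map]

/-- **Covariance of the boosted Kerr–Schild form**: the form of the relabelled motion `(Λ Q, c)` is the
pullback of the form of `(Λ, c)` along `Q̃` (Kerr–Schild 1965, Lorentz covariance of the ansatz — here a
tautology of the definition of the boosted form). [folklore] -/
theorem boostedKerrBilin_relabelMotion :
    boostedKerrBilin (relabelMotion P) c M a = bilinPullback (reflAffine P c) (boostedKerrBilin Λ c M a) := by
  funext x
  ext v w
  rw [bilinPullback_apply, boostedKerrBilin_apply, boostedKerrBilin_apply, fderiv_reflAffine,
    poincareInv_relabelMotion, poincareInv_reflAffine, relabelMotion_symm_apply, relabelMotion_symm_apply]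
  simp only [ContinuousLinearEquiv.coe_coe, labRefl_apply, ContinuousLinearEquiv.symm_apply_apply]

/-- The background form of the relabelled motion is the `Q̃`-pullback of the old one. [folklore] -/
theorem boostedKerrBackground_relabelMotion_bilin :
    (boostedKerrBackground (relabelMotion P) c M a).bilin =
      bilinPullback (reflAffine P c) (boostedKerrBackground Λ c M a).bilin :=
  boostedKerrBilin_relabelMotion P c M a

end Conj

/-! ## §3 `Cᵏ` sup norms of fields of bilinear forms are invariant under affine Euclidean isometries -/

section AffineIsometry

variable {E : Type*} [NormedAddCommGroup E] [NormedSpace ℝ E]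

/-- Composing a bilinear form with a surjective linear isometry in both slots, `β ↦ β(L·, L·)`: a linear
isometry equivalence of `E →L E →L ℝ` (instance arguments spelled out through `NormedAddCommGroup`/`NormedSpace`,
so that Mathlib's `iteratedFDeriv` lemmas unify without unfolding the operator-norm instance diamond). [folklore] -/
def bilinCongr (L : E ≃ₗᵢ[ℝ] E) :
    @LinearIsometryEquiv ℝ ℝ _ _ (RingHom.id ℝ) (RingHom.id ℝ) _ _ (E →L[ℝ] E →L[ℝ] ℝ) (E →L[ℝ] E →L[ℝ] ℝ)
      NormedAddCommGroup.toSeminormedAddCommGroup NormedAddCommGroup.toSeminormedAddCommGroup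
      NormedSpace.toModule NormedSpace.toModule where
  toFun β := β.bilinearComp (L : E →L[ℝ] E) (L : E →L[ℝ] E)
  invFun β := β.bilinearComp (L.symm : E →L[ℝ] E) (L.symm : E →L[ℝ] E)
  map_add' β β' := by ext v w; rfl
  map_smul' r β := by ext v w; rfl
  left_inv β := by ext v w; simp
  right_inv β := by ext v w; simp
  norm_map' β := by
    show ‖((β.comp (L : E →L[ℝ] E)).flip.comp (L : E →L[ℝ] E)).flip‖ = ‖β‖
    rw [ContinuousLinearMap.opNorm_flip, ContinuousLinearMap.opNorm_comp_linearIsometryEquiv,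
      ContinuousLinearMap.opNorm_flip, ContinuousLinearMap.opNorm_comp_linearIsometryEquiv]

/-- `bilinCongr L β v w = β (L v) (L w)`. [folklore] -/
theorem bilinCongr_apply (L : E ≃ₗᵢ[ℝ] E) (β : E →L[ℝ] E →L[ℝ] ℝ) (v w : E) :
    bilinCongr L β v w = β (L v) (L w) := rfl

/-- The coordinate pullback along an affine isometry `θ = c + L(· − c')` is `bilinCongr L ∘ F ∘ θ`. [folklore] -/
theorem bilinPullback_affine_eq (L : E ≃ₗᵢ[ℝ] E) (c c' : E) {θ : E → E} (hθ : ∀ x, θ x = c + L (x - c'))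
    (F : E → E →L[ℝ] E →L[ℝ] ℝ) : bilinPullback θ F = bilinCongr L ∘ F ∘ θ := by
  have hθ' : θ = fun x ↦ c + L (x - c') := funext hθ
  have hd : ∀ x, fderiv ℝ θ x = (L : E →L[ℝ] E) := fun x ↦ by
    rw [hθ']
    have h := ((((L : E →L[ℝ] E)).hasFDerivAt (x := x - c')).comp x ((hasFDerivAt_id x).sub_const c')).const_add c
    rw [ContinuousLinearMap.comp_id] at h
    exact h.fderiv
  funext x
  ext v w
  rw [bilinPullback_apply, hd]
  rfl

/-- **Pointwise invariance**: `‖Dᵐ(bilinPullback θ F)(x)‖ = ‖Dᵐ F (θ x)‖` for an affine Euclidean isometry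
`θ = c + L(· − c')`. [folklore] -/
theorem norm_iteratedFDeriv_bilinPullback_affine (L : E ≃ₗᵢ[ℝ] E) (c c' : E) {θ : E → E}
    (hθ : ∀ x, θ x = c + L (x - c')) (F : E → E →L[ℝ] E →L[ℝ] ℝ) (m : ℕ) (x : E) :
    ‖iteratedFDeriv ℝ m (bilinPullback θ F) x‖ = ‖iteratedFDeriv ℝ m F (θ x)‖ := by
  rw [bilinPullback_affine_eq L c c' hθ F, LinearIsometryEquiv.norm_iteratedFDeriv_comp_left (bilinCongr L) (F ∘ θ) x m]
  have hθ' : F ∘ θ = fun x ↦ ((fun z ↦ F (c + z)) ∘ L) (x - c') := by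
    funext x; simp only [Function.comp_apply, hθ x]
  rw [hθ', iteratedFDeriv_comp_sub (f := (fun z ↦ F (c + z)) ∘ L) m c' x,
    LinearIsometryEquiv.norm_iteratedFDeriv_comp_right, iteratedFDeriv_comp_add_left (f := F) m c, hθ x]

/-- **`Cᵏ` sup norms are invariant under affine Euclidean isometries**:
`supCkENorm S k (bilinPullback θ F) = supCkENorm (θ '' S) k F`. [folklore] -/
theorem supCkENorm_bilinPullback_affine (L : E ≃ₗᵢ[ℝ] E) (c c' : E) {θ : E → E}
    (hθ : ∀ x, θ x = c + L (x - c')) (S : Set E) (k : ℕ) (F : E → E →L[ℝ] E →L[ℝ] ℝ) :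
    supCkENorm S k (bilinPullback θ F) = supCkENorm (θ '' S) k F := by
  unfold supCkENorm
  refine iSup_congr fun m ↦ iSup_congr fun _ ↦ ?_
  rw [iSup_image]
  refine iSup_congr fun x ↦ iSup_congr fun _ ↦ ?_
  rw [← ofReal_norm, ← ofReal_norm, norm_iteratedFDeriv_bilinPullback_affine L c c' hθ]

end AffineIsometry

/-- **Registered brick `stub_supCkENormPullbackAffine`** (line `Sketch` of crux stmt-FinalStateConjecture-18060):
`Cᵏ` sup norms of fields of bilinear forms are invariant under pullback along an affine Euclidean isometry
`θ = c + L(· − c')`: `supCkENorm S k (θ^* F) = supCkENorm (θ '' S) k F`. [folklore] -/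
theorem stub_supCkENormPullbackAffine {E : Type*} [NormedAddCommGroup E] [NormedSpace ℝ E]
    (L : E ≃ₗᵢ[ℝ] E) (c c' : E) (θ : E → E) (hθ : ∀ x, θ x = c + L (x - c')) (S : Set E) (k : ℕ)
    (F : E → E →L[ℝ] E →L[ℝ] ℝ) :
    supCkENorm S k (bilinPullback θ F) = supCkENorm (θ '' S) k F :=
  supCkENorm_bilinPullback_affine L c c' hθ S k F

end Summit.FinalStateConjecture.FinalStateConjecture.Theorems.GapDecaySuffices.Relabel

end
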